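import Summits.CriticalPhenomena.PercolationContinuityZ3.Theorems.Transplant.Slab111VSoundC
import HarnessLib
/-!
# The routing certificate for `ShapedLinkage 3 (Slab111.hexShadow k)`, V′: soundness of the checker — ASSEMBLY of the swap pair

builds on p205010 (kernel theorem, internal audit signed; external expert review pending) — NOT used in this file.  Lane `prim-bschramm`, seat
`prim-bschramm-p2` (gen 35; class C1b; memo `HOME/bschramm/P2-LATTICES.md` §129); helper file (`--supports stmt-CriticalPhenomena-4575 --as helper`).
A checked plan («Slab111VPlan», `PlanD.check`), placed at a reference level `ℓ ≡ cls z` for which the level facts `LevelOK` hold (supplied per kind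
by «Slab111VLevels», «Slab111VSwapPlan»), with the three terminals served by the plan's terminal options (`Serves`, «Slab111VSoundC»), yields a SWAP
PAIR of `VRouteData` («HexShadowVRouteData»): the rigid cores are film paths by «Slab111VSoundA», the terminal packages by `term_pkg`, and the two
routings through the rhombus diamond are exchanged by the diamond lemma of «VDiamond».
* **`swap_of_check`**.
[cite: DuminilCopinSidoraviciusTassion2016, §2.3 (proof of Fact 2: γ_u, γ_v, γ_w and "(z,v) ≺ (z,w)")]
-/

noncomputable section

namespace Summit.CriticalPhenomena.PercolationContinuityZ3.Theorems.Transplant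

open Literature.Probability.Percolation Literature.Probability.LatticeModels SimpleGraph
open scoped Classical

namespace Slab111

variable {k : ℕ}

/-! ## The swap pair -/

/-- **SOUNDNESS OF THE CHECKER.**  A checked plan, a reference level `ℓ ≡ cls z (mod 3)` satisfying the level facts, and terminals `E₁ ≠ E₂`, `w'`
served by the plan's options (cleared; `E₁, E₂` over the rerouting block) yield a swap pair of routings.
[cite: DuminilCopinSidoraviciusTassion2016, §2.3 (proof of Fact 2: γ_u, γ_v, γ_w, "(z,v) ≺ (z,w)")] -/
theorem swap_of_check {z : Site 2} {ℓ : ℤ} {K : BKey} (hℓ : ℓ % 3 = (cls z : ℤ)) (hk5 : 5 ≤ k) {P : PlanD}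
    (hP : P.check (Ctx.of K (cls z) (k % 3)) = true) (hL : LevelOK k (Ctx.of K (cls z) (k % 3)) ℓ P)
    {E₁ E₂ w' : slab111 k} (hne : E₁ ≠ E₂)
    (hE₁ : E₁ ∈ Wset k z K.tR K.tD K.sR K.sD ∩ (hexShadow k).lift (blkR 3 z K.tR K.sR))
    (hE₂ : E₂ ∈ Wset k z K.tR K.tD K.sR K.sD ∩ (hexShadow k).lift (blkR 3 z K.tR K.sR)) (hw' : w' ∈ Wset k z K.tR K.tD K.sR K.sD)
    (h1 : Serves k z ℓ (Ctx.of K (cls z) (k % 3)) P.t1 E₁) (h2 : Serves k z ℓ (Ctx.of K (cls z) (k % 3)) P.t2 E₂)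
    (h3a : Serves k z ℓ (Ctx.of K (cls z) (k % 3)) P.t3a w') (h3b : Serves k z ℓ (Ctx.of K (cls z) (k % 3)) P.t3b w') :
    ∃ r₁ r₂ : VRouteData (film k) (Wset k z K.tR K.tD K.sR K.sD ∩ (hexShadow k).lift (blkR 3 z K.tR K.sR)) (Wset k z K.tR K.tD K.sR K.sD) E₁ E₂ w',
      r₁.y = r₂.b ∧ r₁.b = r₂.y := by
  set C := Ctx.of K (cls z) (k % 3) with hC
  set W := Wset k z K.tR K.tD K.sR K.sD with hWdef
  set WR := Wset k z K.tR K.tD K.sR K.sD ∩ (hexShadow k).lift (blkR 3 z K.tR K.sR) with hWRdef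
  set X : MV → slab111 k := absV k z ℓ with hXdef
  -- unpack the checker
  have hP' := hP
  simp only [PlanD.check, Bool.and_eq_true] at hP'
  obtain ⟨⟨⟨⟨⟨⟨⟨hstruct, hvalid⟩, hnodup⟩, hport⟩, hregion⟩, hterms⟩, -⟩, -⟩ := hP'
  simp only [PlanD.structOK, Bool.and_eq_true, beq_iff_eq] at hstruct
  obtain ⟨⟨⟨⟨⟨⟨⟨⟨⟨⟨⟨hchA, hchB⟩, hchT1⟩, hchT2⟩, hAlast⟩, hBhead⟩, hT1head⟩, hT2head⟩, hAy⟩, hyB⟩, hAb⟩, hbB⟩ := hstruct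
  simp only [PlanD.validOK, Bool.and_eq_true, List.all_eq_true] at hvalid
  obtain ⟨hvalR, hvalW⟩ := hvalid
  simp only [PlanD.nodupOK, Bool.and_eq_true, Bool.not_eq_true', decide_eq_true_eq, List.all_eq_true] at hnodup
  obtain ⟨⟨⟨⟨⟨⟨⟨⟨⟨⟨⟨hndA, hndB⟩, hndT1⟩, hndT2⟩, hyA⟩, hyB'⟩, hbA⟩, hbB'⟩, hyb⟩, hBA⟩, hT1off⟩, hT2off⟩ := hnodup
  simp only [PlanD.portOK, Bool.and_eq_true] at hport
  obtain ⟨⟨⟨hp1, hp2⟩, hp3a⟩, hp3b⟩ := hport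
  simp only [PlanD.regionOK, Bool.and_eq_true, Bool.not_eq_true', List.all_eq_true] at hregion
  obtain ⟨⟨⟨⟨⟨⟨⟨⟨hr1, hr2⟩, hr3a⟩, hr3b⟩, hc12⟩, hc13a⟩, hc23a⟩, hc13b⟩, hc23b⟩ := hregion
  simp only [PlanD.termsOK, Bool.and_eq_true] at hterms
  obtain ⟨⟨⟨ht1, ht2⟩, ht3a⟩, ht3b⟩ := hterms
  obtain ⟨hLrig, hLports⟩ := hL
  -- rigid vertices: validity, range, membership
  have hvOK : ∀ w ∈ P.rigid, vOK w = true := by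
    intro w hw
    rcases mem_rigid_iff.1 hw with h | rfl | rfl | h | h | h
    · exact (hvalR _ (by simp [h])).1
    · exact (hvalR _ (by simp)).1
    · exact (hvalR _ (by simp)).1
    · exact (hvalR _ (by simp [h])).1
    · exact (hvalW _ (by simp [h])).1
    · exact (hvalW _ (by simp [h])).1
  have hcolW : ∀ w ∈ P.rigid, colW C w.1 = true := by
    intro w hw
    rcases mem_rigid_iff.1 hw with h | rfl | rfl | h | h | h
    · exact (colRW_split (hvalR _ (by simp [h])).2).2
    · exact (colRW_split (hvalR _ (by simp)).2).2
    · exact (colRW_split (hvalR _ (by simp)).2).2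
    · exact (colRW_split (hvalR _ (by simp [h])).2).2
    · exact (hvalW _ (by simp [h])).2
    · exact (hvalW _ (by simp [h])).2
  have hadm : ∀ w ∈ P.rigid, MAdm k (shiftMV z ℓ w) := fun w hw => madm_absV hℓ (hvOK w hw) (hLrig w hw).1 (hLrig w hw).2.1
  have hmemW : ∀ w ∈ P.rigid, X w ∈ W := by
    intro w hw
    obtain ⟨h0, hk, c0', c1', c2', c3'⟩ := hLrig w hw
    exact mem_W_absV hℓ (hvOK w hw) (hcolW w hw) h0 hk c0' c1' c2' c3'
  have hmemR : ∀ w ∈ P.A ++ P.y :: P.b :: P.B, X w ∈ WR := by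
    intro w hw
    have hwr : w ∈ P.rigid := by
      simp only [List.mem_append, List.mem_cons] at hw
      rcases hw with h | rfl | rfl | h
      · exact mem_rigid_iff.2 (Or.inl h)
      · exact mem_rigid_iff.2 (Or.inr (Or.inl rfl))
      · exact mem_rigid_iff.2 (Or.inr (Or.inr (Or.inl rfl)))
      · exact mem_rigid_iff.2 (Or.inr (Or.inr (Or.inr (Or.inl h))))
    exact mem_WR_absV hℓ (hvOK w hwr) (hLrig w hwr).1 (hLrig w hwr).2.1 (hmemW w hwr) (colRW_split (hvalR w hw).2).1
  have hinj : ∀ w ∈ P.rigid, ∀ w' ∈ P.rigid, X w = X w' → w = w' := fun w hw w' hw' h => absV_inj (hadm w hw) (hadm w' hw') h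
  -- membership helpers in P.rigid
  have rA : ∀ w ∈ P.A, w ∈ P.rigid := fun w h => mem_rigid_iff.2 (Or.inl h)
  have ry : P.y ∈ P.rigid := mem_rigid_iff.2 (Or.inr (Or.inl rfl))
  have rb : P.b ∈ P.rigid := mem_rigid_iff.2 (Or.inr (Or.inr (Or.inl rfl)))
  have rB : ∀ w ∈ P.B, w ∈ P.rigid := fun w h => mem_rigid_iff.2 (Or.inr (Or.inr (Or.inr (Or.inl h))))
  have rT1 : ∀ w ∈ P.T1, w ∈ P.rigid := fun w h => mem_rigid_iff.2 (Or.inr (Or.inr (Or.inr (Or.inr (Or.inl h)))))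
  have rT2 : ∀ w ∈ P.T2, w ∈ P.rigid := fun w h => mem_rigid_iff.2 (Or.inr (Or.inr (Or.inr (Or.inr (Or.inr h)))))
  -- the core paths
  have hAne : P.A ≠ [] := by rintro h; simp [h] at hAlast
  have hBne : P.B ≠ [] := by rintro h; simp [h] at hBhead
  have hT1ne : P.T1 ≠ [] := by rintro h; simp [h] at hT1head
  have hT2ne : P.T2 ≠ [] := by rintro h; simp [h] at hT2head
  have hAcore := gpath_absV_of_chainB (k := k) hℓ hAne hchA hndA (fun w hw => hvOK w (rA w hw)) (fun w hw => ⟨(hLrig w (rA w hw)).1, (hLrig w (rA w hw)).2.1⟩)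
  have hBcore := gpath_absV_of_chainB (k := k) hℓ hBne hchB hndB (fun w hw => hvOK w (rB w hw)) (fun w hw => ⟨(hLrig w (rB w hw)).1, (hLrig w (rB w hw)).2.1⟩)
  have hT1core := gpath_absV_of_chainB (k := k) hℓ hT1ne hchT1 hndT1 (fun w hw => hvOK w (rT1 w hw)) (fun w hw => ⟨(hLrig w (rT1 w hw)).1, (hLrig w (rT1 w hw)).2.1⟩)
  have hT2core := gpath_absV_of_chainB (k := k) hℓ hT2ne hchT2 hndT2 (fun w hw => hvOK w (rT2 w hw)) (fun w hw => ⟨(hLrig w (rT2 w hw)).1, (hLrig w (rT2 w hw)).2.1⟩)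
  -- ends of the cores
  have hAl : P.A.getLast hAne = P.cA := by rw [List.getLast?_eq_some_getLast hAne] at hAlast; simpa using hAlast
  have hBh : P.B.head hBne = P.cB := by rw [List.head?_eq_some_head hBne] at hBhead; simpa using hBhead
  have hT1h : P.T1.head hT1ne = P.b := by rw [List.head?_eq_some_head hT1ne] at hT1head; simpa using hT1head
  have hT2h : P.T2.head hT2ne = P.y := by rw [List.head?_eq_some_head hT2ne] at hT2head; simpa using hT2head
  rw [hAl] at hAcore; rw [hBh] at hBcore; rw [hT1h] at hT1core; rw [hT2h] at hT2core
  -- ports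
  set p1 := P.A.head hAne with hp1def
  set p2 := P.B.getLast hBne with hp2def
  set p3a := P.T1.getLast hT1ne with hp3adef
  set p3b := P.T2.getLast hT2ne with hp3bdef
  have hp1' : P.t1.isPort p1 = true := by rw [List.head?_eq_some_head hAne] at hp1; simpa using hp1
  have hp2' : P.t2.isPort p2 = true := by rw [List.getLast?_eq_some_getLast hBne] at hp2; simpa using hp2
  have hp3a' : P.t3a.isPort p3a = true := by rw [List.getLast?_eq_some_getLast hT1ne] at hp3a; simpa using hp3a
  have hp3b' : P.t3b.isPort p3b = true := by rw [List.getLast?_eq_some_getLast hT2ne] at hp3b; simpa using hp3b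
  have hp1A : p1 ∈ P.A := List.head_mem hAne
  have hp2B : p2 ∈ P.B := List.getLast_mem hBne
  have hp3aT : p3a ∈ P.T1 := List.getLast_mem hT1ne
  have hp3bT : p3b ∈ P.T2 := List.getLast_mem hT2ne
  -- port boundary facts from LevelOK
  have hportfacts : ∀ (t : TermD) (p : MV), (t, p) ∈ P.ridePorts →
      (∀ a e, t = TermD.ride a e → ℓ + p.2 = 0 → codeFree C 1 (a.colBot (cls z) 1) = true) ∧
      (∀ a e, t = TermD.ride a e → ℓ + p.2 = k → codeFree C 2 (a.colTop (cls z) (k % 3) 1) = true) := by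
    intro t p htp
    have := hLports (t, p) htp
    constructor
    · rintro a e rfl h0; exact (this.1 h0)
    · rintro a e rfl hk; exact (this.2 hk)
  have hrp1 : ∀ a e, P.t1 = TermD.ride a e → (P.t1, p1) ∈ P.ridePorts := by
    intro a e h; simp only [PlanD.ridePorts, h, List.head?_eq_some_head hAne, List.mem_append, List.mem_singleton]; simp [hp1def]
  have hrp2 : ∀ a e, P.t2 = TermD.ride a e → (P.t2, p2) ∈ P.ridePorts := by
    intro a e h; simp only [PlanD.ridePorts, h, List.getLast?_eq_some_getLast hBne, List.mem_append, List.mem_singleton]; simp [hp2def]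
  have hrp3a : ∀ a e, P.t3a = TermD.ride a e → (P.t3a, p3a) ∈ P.ridePorts := by
    intro a e h; simp only [PlanD.ridePorts, h, List.getLast?_eq_some_getLast hT1ne, List.mem_append, List.mem_singleton]; simp [hp3adef]
  have hrp3b : ∀ a e, P.t3b = TermD.ride a e → (P.t3b, p3b) ∈ P.ridePorts := by
    intro a e h; simp only [PlanD.ridePorts, h, List.getLast?_eq_some_getLast hT2ne, List.mem_append, List.mem_singleton]; simp [hp3bdef]
  -- terminal packages
  obtain ⟨R1, hR1, hR1reg, -, hR1R⟩ := term_pkg (roleE := true) hℓ hk5 ht1 hp1' (hvOK p1 (rA p1 hp1A)) (hLrig p1 (rA p1 hp1A)).1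
    (hLrig p1 (rA p1 hp1A)).2.1 (hmemW p1 (rA p1 hp1A)) (fun _ => hmemR p1 (by simp [hp1A]))
    (fun a e h => (hportfacts _ _ (hrp1 a e h)).1 a e h) (fun a e h => (hportfacts _ _ (hrp1 a e h)).2 a e h) h1 hE₁.1 (fun _ => hE₁)
  obtain ⟨R2, hR2, hR2reg, -, hR2R⟩ := term_pkg (roleE := true) hℓ hk5 ht2 hp2' (hvOK p2 (rB p2 hp2B)) (hLrig p2 (rB p2 hp2B)).1
    (hLrig p2 (rB p2 hp2B)).2.1 (hmemW p2 (rB p2 hp2B)) (fun _ => hmemR p2 (by simp [hp2B]))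
    (fun a e h => (hportfacts _ _ (hrp2 a e h)).1 a e h) (fun a e h => (hportfacts _ _ (hrp2 a e h)).2 a e h) h2 hE₂.1 (fun _ => hE₂)
  obtain ⟨R3a, hR3a, hR3areg, hR3aW, -⟩ := term_pkg (roleE := false) hℓ hk5 ht3a hp3a' (hvOK p3a (rT1 p3a hp3aT)) (hLrig p3a (rT1 p3a hp3aT)).1
    (hLrig p3a (rT1 p3a hp3aT)).2.1 (hmemW p3a (rT1 p3a hp3aT)) (fun h => by simp at h)
    (fun a e h => (hportfacts _ _ (hrp3a a e h)).1 a e h) (fun a e h => (hportfacts _ _ (hrp3a a e h)).2 a e h) h3a hw' (fun h => by simp at h)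
  obtain ⟨R3b, hR3b, hR3breg, hR3bW, -⟩ := term_pkg (roleE := false) hℓ hk5 ht3b hp3b' (hvOK p3b (rT2 p3b hp3bT)) (hLrig p3b (rT2 p3b hp3bT)).1
    (hLrig p3b (rT2 p3b hp3bT)).2.1 (hmemW p3b (rT2 p3b hp3bT)) (fun h => by simp at h)
    (fun a e h => (hportfacts _ _ (hrp3b a e h)).1 a e h) (fun a e h => (hportfacts _ _ (hrp3b a e h)).2 a e h) h3b hw' (fun h => by simp at h)
  have hR1R' := hR1R rfl
  have hR2R' := hR2R rfl
  -- KEY SEPARATION FACTS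
  -- (a) a rigid vertex not blocked by option t is off t's ride (except possibly the port)
  have sepRig : ∀ {t : TermD} {R : List (slab111 k)} {p : MV}, (∀ v ∈ R, v = X p ∨ InReg z ℓ t v) → p ∈ P.rigid →
      ∀ w ∈ P.rigid, t.blocks w = false → w ≠ p → X w ∉ R := by
    intro t R p hRreg hp w hw hnb hwp hmem
    rcases hRreg _ hmem with h | h
    · exact hwp (hinj w hw p hp h)
    · exact ne_of_inReg h (hadm w hw) hnb rfl
  -- (b) two rides of non-clashing options meet at most... never (ports are rigid and distinct / unblocked)
  have sepRide : ∀ {t t' : TermD} {R R' : List (slab111 k)} {p p' : MV}, (∀ v ∈ R, v = X p ∨ InReg z ℓ t v) → (∀ v ∈ R', v = X p' ∨ InReg z ℓ t' v) →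
      t.clash t' = false → p ∈ P.rigid → p' ∈ P.rigid → p ≠ p' → t.blocks p' = false → t'.blocks p = false →
      ∀ v ∈ R, v ∉ R' := by
    intro t t' R R' p p' hR hR' hcl hp hp' hpp hnb' hnb v hv hv'
    rcases hR v hv with h | h <;> rcases hR' v hv' with h' | h'
    · exact hpp (hinj p hp p' hp' (h ▸ h'))
    · exact ne_of_inReg h' (hadm p hp) hnb (h ▸ rfl)
    · exact ne_of_inReg h (hadm p' hp') hnb' (h' ▸ rfl)
    · exact ne_of_inReg_inReg h h' hcl rfl
  -- full paths
  -- A: E₁ → cA  :  R1.reverse ++ (A.map X).tail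
  have hAfull : GPath (film k) (R1.reverse ++ (P.A.map X).tail) E₁ (X P.cA) := by
    refine hR1.reverse.trans hAcore fun v hv hvR => ?_
    obtain ⟨w, hw, rfl⟩ := List.mem_map.1 hv
    by_cases hwp : w = p1
    · rw [hwp]
    · exact absurd (List.mem_reverse.1 hvR) (sepRig hR1reg (rA p1 hp1A) w (rA w hw) (hr1 w (by simp [mem_tail_of_ne_head hw (List.head?_eq_some_head hAne) hwp])) hwp)
  -- B: cB → E₂  :  (B.map X) ++ R2.tail
  have hBfull : GPath (film k) (P.B.map X ++ R2.tail) (X P.cB) E₂ := by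
    refine hBcore.trans hR2 fun v hvR hv => ?_
    obtain ⟨w, hw, rfl⟩ := List.mem_map.1 hv
    by_cases hwp : w = p2
    · rw [hwp]
    · exact absurd hvR (sepRig hR2reg (rB p2 hp2B) w (rB w hw) (hr2 w (by simp [mem_dropLast_of_ne_getLast hw (List.getLast?_eq_some_getLast hBne) hwp])) hwp)
  -- T₁: b → w'  :  (T1.map X) ++ R3a.tail ;  T₂: y → w'
  have hT1full : GPath (film k) (P.T1.map X ++ R3a.tail) (X P.b) w' := by
    refine hT1core.trans hR3a fun v hvR hv => ?_
    obtain ⟨w, hw, rfl⟩ := List.mem_map.1 hv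
    by_cases hwp : w = p3a
    · rw [hwp]
    · exact absurd hvR (sepRig hR3areg (rT1 p3a hp3aT) w (rT1 w hw) (hr3a w (by simp [mem_dropLast_of_ne_getLast hw (List.getLast?_eq_some_getLast hT1ne) hwp])) hwp)
  have hT2full : GPath (film k) (P.T2.map X ++ R3b.tail) (X P.y) w' := by
    refine hT2core.trans hR3b fun v hvR hv => ?_
    obtain ⟨w, hw, rfl⟩ := List.mem_map.1 hv
    by_cases hwp : w = p3b
    · rw [hwp]
    · exact absurd hvR (sepRig hR3breg (rT2 p3b hp3bT) w (rT2 w hw) (hr3b w (by simp [mem_dropLast_of_ne_getLast hw (List.getLast?_eq_some_getLast hT2ne) hwp])) hwp)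
  -- diamond adjacencies
  have hcA_rig : P.cA ∈ P.rigid := rA _ (hAl ▸ List.getLast_mem hAne)
  have hcB_rig : P.cB ∈ P.rigid := rB _ (hBh ▸ List.head_mem hBne)
  have hcy : (film k).Adj (X P.cA) (X P.y) := adj_absV (hadm _ hcA_rig) (hadm _ ry) (mstepB_iff.1 hAy)
  have hcb : (film k).Adj (X P.cA) (X P.b) := adj_absV (hadm _ hcA_rig) (hadm _ rb) (mstepB_iff.1 hAb)
  have hyd : (film k).Adj (X P.y) (X P.cB) := adj_absV (hadm _ ry) (hadm _ hcB_rig) (mstepB_iff.1 hyB)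
  have hbd : (film k).Adj (X P.b) (X P.cB) := adj_absV (hadm _ rb) (hadm _ hcB_rig) (mstepB_iff.1 hbB)
  -- membership helpers for the concatenations
  have memA : ∀ v, v ∈ R1.reverse ++ (P.A.map X).tail → v ∈ R1 ∨ ∃ w ∈ P.A, v = X w := by
    intro v hv
    rcases List.mem_append.1 hv with h | h
    · exact Or.inl (List.mem_reverse.1 h)
    · obtain ⟨w, hw, rfl⟩ := List.mem_map.1 (List.mem_of_mem_tail h); exact Or.inr ⟨w, hw, rfl⟩
  have memB : ∀ v, v ∈ P.B.map X ++ R2.tail → (∃ w ∈ P.B, v = X w) ∨ v ∈ R2 := by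
    intro v hv
    rcases List.mem_append.1 hv with h | h
    · obtain ⟨w, hw, rfl⟩ := List.mem_map.1 h; exact Or.inl ⟨w, hw, rfl⟩
    · exact Or.inr (List.mem_of_mem_tail h)
  have memT1 : ∀ v, v ∈ P.T1.map X ++ R3a.tail → (∃ w ∈ P.T1, v = X w) ∨ v ∈ R3a := by
    intro v hv
    rcases List.mem_append.1 hv with h | h
    · obtain ⟨w, hw, rfl⟩ := List.mem_map.1 h; exact Or.inl ⟨w, hw, rfl⟩
    · exact Or.inr (List.mem_of_mem_tail h)
  have memT2 : ∀ v, v ∈ P.T2.map X ++ R3b.tail → (∃ w ∈ P.T2, v = X w) ∨ v ∈ R3b := by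
    intro v hv
    rcases List.mem_append.1 hv with h | h
    · obtain ⟨w, hw, rfl⟩ := List.mem_map.1 h; exact Or.inl ⟨w, hw, rfl⟩
    · exact Or.inr (List.mem_of_mem_tail h)
  -- Boolean list facts in usable form
  have nA : ∀ w ∈ P.A, w ≠ P.y ∧ w ≠ P.b := fun w hw => ⟨fun h => by simp [← h, hw] at hyA, fun h => by simp [← h, hw] at hbA⟩
  have nB : ∀ w ∈ P.B, w ≠ P.y ∧ w ≠ P.b ∧ w ∉ P.A := fun w hw =>
    ⟨fun h => by simp [← h, hw] at hyB', fun h => by simp [← h, hw] at hbB', fun h => by have := hBA w hw; simp [h] at this⟩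
  have nT1 : ∀ w ∈ P.T1, w ∉ P.A ∧ w ≠ P.y ∧ w ∉ P.B := fun w hw =>
    ⟨notin_of_contains_false (hT1off w hw).1.1, ne_of_beq_false' (hT1off w hw).1.2, notin_of_contains_false (hT1off w hw).2⟩
  have nT2 : ∀ w ∈ P.T2, w ∉ P.A ∧ w ≠ P.b ∧ w ∉ P.B := fun w hw =>
    ⟨notin_of_contains_false (hT2off w hw).1.1, ne_of_beq_false' (hT2off w hw).1.2, notin_of_contains_false (hT2off w hw).2⟩
  -- blocks facts in usable form: hr1 : ∀ w ∈ (A.tail ++ y :: b :: B ++ T1 ++ T2), t1.blocks w = false, etc.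
  have b1 : ∀ w, (w ∈ P.A ∧ w ≠ p1) ∨ w = P.y ∨ w = P.b ∨ w ∈ P.B ∨ w ∈ P.T1 ∨ w ∈ P.T2 → P.t1.blocks w = false := by
    intro w hw; apply hr1
    simp only [List.mem_append, List.mem_cons]
    rcases hw with ⟨h, hne⟩ | rfl | rfl | h | h | h
    · have := mem_tail_of_ne_head h (List.head?_eq_some_head hAne) hne; simp [this]
    · simp
    · simp
    · simp [h]
    · simp [h]
    · simp [h]
  have b2 : ∀ w, w ∈ P.A ∨ w = P.y ∨ w = P.b ∨ (w ∈ P.B ∧ w ≠ p2) ∨ w ∈ P.T1 ∨ w ∈ P.T2 → P.t2.blocks w = false := by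
    intro w hw; apply hr2
    simp only [List.mem_append, List.mem_cons]
    rcases hw with h | rfl | rfl | ⟨h, hne⟩ | h | h
    · simp [h]
    · simp
    · simp
    · have := mem_dropLast_of_ne_getLast h (List.getLast?_eq_some_getLast hBne) hne; simp [this]
    · simp [h]
    · simp [h]
  have b3a : ∀ w, w ∈ P.A ∨ w = P.y ∨ w ∈ P.B ∨ (w ∈ P.T1 ∧ w ≠ p3a) → P.t3a.blocks w = false := by
    intro w hw; apply hr3a
    simp only [List.mem_append, List.mem_cons]
    rcases hw with h | rfl | h | ⟨h, hne⟩
    · simp [h]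
    · simp
    · simp [h]
    · have := mem_dropLast_of_ne_getLast h (List.getLast?_eq_some_getLast hT1ne) hne; simp [this]
  have b3b : ∀ w, w ∈ P.A ∨ w = P.b ∨ w ∈ P.B ∨ (w ∈ P.T2 ∧ w ≠ p3b) → P.t3b.blocks w = false := by
    intro w hw; apply hr3b
    simp only [List.mem_append, List.mem_cons]
    rcases hw with h | rfl | h | ⟨h, hne⟩
    · simp [h]
    · simp
    · simp [h]
    · have := mem_dropLast_of_ne_getLast h (List.getLast?_eq_some_getLast hT2ne) hne; simp [this]
  -- y, b off A and B
  have hyA_full : X P.y ∉ R1.reverse ++ (P.A.map X).tail := by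
    intro h
    rcases memA _ h with h | ⟨w, hw, he⟩
    · exact sepRig hR1reg (rA p1 hp1A) P.y ry (b1 _ (Or.inr (Or.inl rfl))) (fun e => (nA p1 hp1A).1 e.symm) h
    · exact (nA w hw).1 (hinj w (rA w hw) _ ry he.symm)
  have hbA_full : X P.b ∉ R1.reverse ++ (P.A.map X).tail := by
    intro h
    rcases memA _ h with h | ⟨w, hw, he⟩
    · exact sepRig hR1reg (rA p1 hp1A) P.b rb (b1 _ (Or.inr (Or.inr (Or.inl rfl)))) (fun e => (nA p1 hp1A).2 e.symm) h
    · exact (nA w hw).2 (hinj w (rA w hw) _ rb he.symm)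
  have hyB_full : X P.y ∉ P.B.map X ++ R2.tail := by
    intro h
    rcases memB _ h with ⟨w, hw, he⟩ | h
    · exact (nB w hw).1 (hinj w (rB w hw) _ ry he.symm)
    · exact sepRig hR2reg (rB p2 hp2B) P.y ry (b2 _ (Or.inr (Or.inl rfl))) (fun e => (nB p2 hp2B).1 e.symm) h
  have hbB_full : X P.b ∉ P.B.map X ++ R2.tail := by
    intro h
    rcases memB _ h with ⟨w, hw, he⟩ | h
    · exact (nB w hw).2.1 (hinj w (rB w hw) _ rb he.symm)
    · exact sepRig hR2reg (rB p2 hp2B) P.b rb (b2 _ (Or.inr (Or.inr (Or.inl rfl)))) (fun e => (nB p2 hp2B).2.1 e.symm) h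
  -- A ∩ B = ∅
  have hp12 : p1 ≠ p2 := fun e => (nB p2 hp2B).2.2 (e ▸ hp1A)
  have hAB_full : ∀ x ∈ P.B.map X ++ R2.tail, x ∉ R1.reverse ++ (P.A.map X).tail := by
    intro x hxB hxA
    rcases memB _ hxB with ⟨w, hw, rfl⟩ | hxR2 <;> rcases memA _ hxA with hxR1 | ⟨w', hw', he⟩
    · exact sepRig hR1reg (rA p1 hp1A) w (rB w hw) (b1 _ (Or.inr (Or.inr (Or.inr (Or.inl hw))))) (fun e => (nB w hw).2.2 (e ▸ hp1A)) hxR1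
    · exact (nB w hw).2.2 ((hinj w (rB w hw) w' (rA w' hw') he) ▸ hw')
    · exact sepRide hR2reg hR1reg (clash_comm hc12) (rB p2 hp2B) (rA p1 hp1A) hp12.symm (b2 _ (Or.inl hp1A)) (b1 _ (Or.inr (Or.inr (Or.inr (Or.inl hp2B))))) x hxR2 hxR1
    · exact sepRig hR2reg (rB p2 hp2B) w' (rA w' hw') (b2 _ (Or.inl hw')) (fun e => (nB p2 hp2B).2.2 (e ▸ hw')) (he ▸ hxR2)
  -- T₁ off A ++ y :: B
  have hT1off_full : ∀ x ∈ P.T1.map X ++ R3a.tail, x ∉ (R1.reverse ++ (P.A.map X).tail) ++ X P.y :: (P.B.map X ++ R2.tail) := by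
    intro x hxT hx
    simp only [List.mem_append, List.mem_cons] at hx
    rcases memT1 _ hxT with ⟨w, hw, rfl⟩ | hxR3
    · -- x is a rigid vertex of T1
      rcases hx with hxA | rfl' | hxB
      · rcases memA _ (by simpa using hxA) with hR | ⟨w', hw', he⟩
        · exact sepRig hR1reg (rA p1 hp1A) w (rT1 w hw) (b1 _ (Or.inr (Or.inr (Or.inr (Or.inr (Or.inl hw)))))) (fun e => (nT1 w hw).1 (e ▸ hp1A)) hR
        · exact (nT1 w hw).1 ((hinj w (rT1 w hw) w' (rA w' hw') he) ▸ hw')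
      · exact (nT1 w hw).2.1 (hinj w (rT1 w hw) _ ry rfl')
      · rcases memB _ (by simpa using hxB) with ⟨w', hw', he⟩ | hR
        · exact (nT1 w hw).2.2 ((hinj w (rT1 w hw) w' (rB w' hw') he) ▸ hw')
        · exact sepRig hR2reg (rB p2 hp2B) w (rT1 w hw) (b2 _ (Or.inr (Or.inr (Or.inr (Or.inr (Or.inl hw)))))) (fun e => (nT1 w hw).2.2 (e ▸ hp2B)) hR
    · -- x is on the ride of w' (routing 1)
      rcases hx with hxA | hxy | hxB
      · rcases memA _ (by simpa using hxA) with hR | ⟨w', hw', he⟩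
        · exact sepRide hR3areg hR1reg (clash_comm hc13a) (rT1 p3a hp3aT) (rA p1 hp1A) (fun e => (nT1 p3a hp3aT).1 (e ▸ hp1A))
            (b3a _ (Or.inl hp1A)) (b1 _ (Or.inr (Or.inr (Or.inr (Or.inr (Or.inl hp3aT)))))) x hxR3 hR
        · exact sepRig hR3areg (rT1 p3a hp3aT) w' (rA w' hw') (b3a _ (Or.inl hw')) (fun e => (nT1 p3a hp3aT).1 (e ▸ hw')) (he ▸ hxR3)
      · exact sepRig hR3areg (rT1 p3a hp3aT) P.y ry (b3a _ (Or.inr (Or.inl rfl))) (fun e => (nT1 p3a hp3aT).2.1 e.symm) (hxy ▸ hxR3)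
      · rcases memB _ (by simpa using hxB) with ⟨w', hw', he⟩ | hR
        · exact sepRig hR3areg (rT1 p3a hp3aT) w' (rB w' hw') (b3a _ (Or.inr (Or.inr (Or.inl hw')))) (fun e => (nT1 p3a hp3aT).2.2 (e ▸ hw')) (he ▸ hxR3)
        · exact sepRide hR3areg hR2reg (clash_comm hc23a) (rT1 p3a hp3aT) (rB p2 hp2B) (fun e => (nT1 p3a hp3aT).2.2 (e ▸ hp2B))
            (b3a _ (Or.inr (Or.inr (Or.inl hp2B)))) (b2 _ (Or.inr (Or.inr (Or.inr (Or.inr (Or.inl hp3aT)))))) x hxR3 hR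
  -- T₂ off A ++ b :: B
  have hT2off_full : ∀ x ∈ P.T2.map X ++ R3b.tail, x ∉ (R1.reverse ++ (P.A.map X).tail) ++ X P.b :: (P.B.map X ++ R2.tail) := by
    intro x hxT hx
    simp only [List.mem_append, List.mem_cons] at hx
    rcases memT2 _ hxT with ⟨w, hw, rfl⟩ | hxR3
    · rcases hx with hxA | rfl' | hxB
      · rcases memA _ (by simpa using hxA) with hR | ⟨w', hw', he⟩
        · exact sepRig hR1reg (rA p1 hp1A) w (rT2 w hw) (b1 _ (Or.inr (Or.inr (Or.inr (Or.inr (Or.inr hw)))))) (fun e => (nT2 w hw).1 (e ▸ hp1A)) hR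
        · exact (nT2 w hw).1 ((hinj w (rT2 w hw) w' (rA w' hw') he) ▸ hw')
      · exact (nT2 w hw).2.1 (hinj w (rT2 w hw) _ rb rfl')
      · rcases memB _ (by simpa using hxB) with ⟨w', hw', he⟩ | hR
        · exact (nT2 w hw).2.2 ((hinj w (rT2 w hw) w' (rB w' hw') he) ▸ hw')
        · exact sepRig hR2reg (rB p2 hp2B) w (rT2 w hw) (b2 _ (Or.inr (Or.inr (Or.inr (Or.inr (Or.inr hw)))))) (fun e => (nT2 w hw).2.2 (e ▸ hp2B)) hR
    · rcases hx with hxA | hxb | hxB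
      · rcases memA _ (by simpa using hxA) with hR | ⟨w', hw', he⟩
        · exact sepRide hR3breg hR1reg (clash_comm hc13b) (rT2 p3b hp3bT) (rA p1 hp1A) (fun e => (nT2 p3b hp3bT).1 (e ▸ hp1A))
            (b3b _ (Or.inl hp1A)) (b1 _ (Or.inr (Or.inr (Or.inr (Or.inr (Or.inr hp3bT)))))) x hxR3 hR
        · exact sepRig hR3breg (rT2 p3b hp3bT) w' (rA w' hw') (b3b _ (Or.inl hw')) (fun e => (nT2 p3b hp3bT).1 (e ▸ hw')) (he ▸ hxR3)
      · exact sepRig hR3breg (rT2 p3b hp3bT) P.b rb (b3b _ (Or.inr (Or.inl rfl))) (fun e => (nT2 p3b hp3bT).2.1 e.symm) (hxb ▸ hxR3)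
      · rcases memB _ (by simpa using hxB) with ⟨w', hw', he⟩ | hR
        · exact sepRig hR3breg (rT2 p3b hp3bT) w' (rB w' hw') (b3b _ (Or.inr (Or.inr (Or.inl hw')))) (fun e => (nT2 p3b hp3bT).2.2 (e ▸ hw')) (he ▸ hxR3)
        · exact sepRide hR3breg hR2reg (clash_comm hc23b) (rT2 p3b hp3bT) (rB p2 hp2B) (fun e => (nT2 p3b hp3bT).2.2 (e ▸ hp2B))
            (b3b _ (Or.inr (Or.inr (Or.inl hp2B)))) (b2 _ (Or.inr (Or.inr (Or.inr (Or.inr (Or.inr hp3bT)))))) x hxR3 hR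
  -- memberships
  have hAW : ∀ x ∈ R1.reverse ++ (P.A.map X).tail, x ∈ WR := by
    intro x hx
    rcases memA _ hx with h | ⟨w, hw, rfl⟩
    · exact hR1R' x h
    · exact hmemR w (by simp [hw])
  have hBW : ∀ x ∈ P.B.map X ++ R2.tail, x ∈ WR := by
    intro x hx
    rcases memB _ hx with ⟨w, hw, rfl⟩ | h
    · exact hmemR w (by simp [hw])
    · exact hR2R' x h
  have hT1W : ∀ x ∈ P.T1.map X ++ R3a.tail, x ∈ W := by
    intro x hx
    rcases memT1 _ hx with ⟨w, hw, rfl⟩ | h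
    · exact hmemW w (rT1 w hw)
    · exact hR3aW x h
  have hT2W : ∀ x ∈ P.T2.map X ++ R3b.tail, x ∈ W := by
    intro x hx
    rcases memT2 _ hx with ⟨w, hw, rfl⟩ | h
    · exact hmemW w (rT2 w hw)
    · exact hR3bW x h
  exact VRouteData.exists_swap_of_diamond hne hAfull hBfull hT1full hT2full hcy hcb hyd hbd hyA_full hyB_full hbA_full hbB_full hAB_full
    hT1off_full hT2off_full hAW hBW (hmemR P.y (by simp)) (hmemR P.b (by simp)) hT1W hT2W

end Slab111

end Summit.CriticalPhenomena.PercolationContinuityZ3.Theorems.Transplant
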